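import Summits.Parity.GeneralizedHardyLittlewood.Theorems.PrimeLevelFamEdgeMomentsBeyondDiagonalLayersFarPOfPascadi
import Summits.Parity.GeneralizedHardyLittlewood.Theorems.PrimeLevelFamEdgeMomentsBeyondDiagonalFirstMomentAllQ
import HarnessLib

/-!
# Route `PrimeLevelFamEdge`, crux K_A `MomentsBeyondDiagonal` (stmt-Parity-20007), line «petersson_layers» v4:
# the RESIDUAL of the line after `stub_first`, `stub_identP` (landed by name) and `stub_farP` (conditional on Pascadi)

The registered composition of the line (`Cruxes/MomentsBeyondDiagonal/Lines/petersson_layers.lean`, `MomentsBeyondDiagonal_of`) is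
the deck theorem `…PrimeLevelFamEdgeIdeaDeltas.PeterssonLayers.MomentsBeyondDiagonal_of_sevenSplitBands` applied to the seven stubs.
Three of the seven are now kernel facts of the tree — `stub_first` (`…FirstOrderAFE.stub_first`, p803664), `stub_identP`
(`…TwoOrderAFE.stub_identP`, p795653) — or conditional kernel facts — `stub_farP` modulo Pascadi's Theorem 7.1
(`…Layers.subFar_rhoP_of_pascadi`, this lineage).  Composing them:
* **`momentsBeyondDiagonal_of_pascadi_of_heart`**: `pascadi2025_theorem71 → SubDiag → SubRung → SubUpper rhoCore →
  SubBand rhoCore rhoP → MomentsBeyondDiagonal` — i.e. the crux K_A now follows BY NAME from the named fact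
  `Literature.NumberTheory.LFunctions.pascadi2025_theorem71` and the FOUR remaining registered stubs `stub_diag`, `stub_rung`,
  `stub_core`, `stub_band` (the heart: diagonal shape, the rung `c = q`, the core layers, the band).
Honest label: a kernel-checked bookkeeping certificate of what is left, NOT progress on the heart; `stub_core`/`stub_rung`/`stub_band`
are the K_A content (open in print, registry famE-02); K_A / K_B / Parity NOT proved; nothing about Landau–Siegel zeros.
-/

noncomputable section

open Literature.NumberTheory.LFunctions

namespace Summit.Parity.GeneralizedHardyLittlewood.Theorems.MomentsBeyondDiagonal.Layers

open Summit.Parity.GeneralizedHardyLittlewood.Theses.PrimeLevelFamEdge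
open Summit.Parity.GeneralizedHardyLittlewood.Theorems.PrimeLevelFamEdgeIdeaDeltas.PairsSplit (SubFirst)
open Summit.Parity.GeneralizedHardyLittlewood.Theorems.PrimeLevelFamEdgeIdeaDeltas.PeterssonLayers

/-- **K_A from Pascadi's Theorem 7.1 and the four heart stubs of the line «petersson_layers»** (composition of the deck's
`MomentsBeyondDiagonal_of_sevenSplitBands` with the landed `stub_first`, `stub_identP` and the conditional `stub_farP`).
[cite: Pascadi2025, Thm. 7.1] -/
theorem momentsBeyondDiagonal_of_pascadi_of_heart (h : pascadi2025_theorem71) (hD : SubDiag) (hR : SubRung)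
    (hC : SubUpper rhoCore) (hB : SubBand rhoCore rhoP) : MomentsBeyondDiagonal :=
  MomentsBeyondDiagonal_of_sevenSplitBands FirstOrderAFE.stub_first hD hR hC hB TwoOrderAFE.stub_identP
    (subFar_rhoP_of_pascadi h)

end Summit.Parity.GeneralizedHardyLittlewood.Theorems.MomentsBeyondDiagonal.Layers

end
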